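import Mathlib.Analysis.Calculus.ContDiff.Bounds
import Mathlib.Analysis.InnerProductSpace.PiL2
import HarnessLib

/-!
# Crux `MixingPayoff` (stmt-NavierStokesRegularity-1422), line `birth`, stub W2
  (`stub_advectionDiffusionSchwartz`): the autonomous "clock" system of a linear parabolic
  equation with time-dependent coefficients — smoothness and derivative bounds

Helper file (lands `--supports stmt-NavierStokesRegularity-1422`). The linear equation
`∂ₜψ = Δψ + ⟪β(t,x), ∇ψ⟫ + γ(t,x)ψ` with time-dependent coefficients is not of the autonomous
form `∂ₜu = Δu + f(x, u, ∂u)` treated by the tree's semilinear heat solver; adjoining the clock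
`σ` (`∂ₜσ = Δσ + 1`, `σ(0) = t₀`, so `σ = t₀ + t`) makes it autonomous for the pair
`u = (ψ, σ)` with the nonlinearity

  `F(x, (ψ, σ), P) = ((P (β σ x))₁ + γ σ x · ψ, 1)`.

This file proves that `F` is `C^∞` (`clock_contDiff`) and that all its derivatives of order
`≤ n` are bounded on `E × {‖w‖ ≤ R}` (`clock_bounds`, hypothesis `hB` of the solver) when `β`,
`γ` are jointly `C^∞` with all derivatives bounded, through Leibniz bounds for bilinear
expressions with uniformly bounded factors.
-/

noncomputable section

open Set Function Filter Metric Real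
open scoped ContDiff

-- `Summit = Problem` for this summit; the tree lakefile sets `weak.linter.dupNamespace = false`.
set_option linter.dupNamespace false

namespace Summit.NavierStokesRegularity.NavierStokesRegularity.Theorems.SelfMixingDichotomy.MixingPayoffBirth

-- nested operator types
set_option maxSynthPendingDepth 3

section Clock

variable {E : Type} [NormedAddCommGroup E] [InnerProductSpace ℝ E]

/-- Iterated derivatives of a continuous linear map: `‖Dⁿ A (x)‖ ≤ ‖A x‖ + ‖A‖` (order `0`: the
value; order `1`: the map itself; order `≥ 2`: zero). -/
theorem norm_iteratedFDeriv_clm_le {X Y : Type*} [NormedAddCommGroup X] [NormedSpace ℝ X]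
    [NormedAddCommGroup Y] [NormedSpace ℝ Y] (A : X →L[ℝ] Y) (n : ℕ) (x : X) :
    ‖iteratedFDeriv ℝ n A x‖ ≤ ‖A x‖ + ‖A‖ := by
  rcases n with _ | n
  · rw [norm_iteratedFDeriv_zero]; linarith [norm_nonneg A]
  · rw [← norm_iteratedFDeriv_fderiv, show fderiv ℝ (⇑A) = fun _ => A from funext fun y => A.fderiv]
    rcases n with _ | n
    · simp
    · rw [iteratedFDeriv_const_of_ne (by omega)]
      simp only [Pi.zero_apply, norm_zero]
      positivity

/-- **Leibniz bound for a bilinear expression with uniformly bounded factors**: if all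
derivatives of order `≤ n` of `f` and `g` are bounded by `Cf`, `Cg` on a set `S`, then all
derivatives of order `≤ n` of `B (f ·) (g ·)` are bounded by `‖B‖ 2ⁿ Cf Cg` on `S`. -/
theorem norm_iteratedFDeriv_bilinear_le_uniform {X M N P : Type*} [NormedAddCommGroup X]
    [NormedSpace ℝ X] [NormedAddCommGroup M] [NormedSpace ℝ M] [NormedAddCommGroup N]
    [NormedSpace ℝ N] [NormedAddCommGroup P] [NormedSpace ℝ P] (B : M →L[ℝ] N →L[ℝ] P)
    {f : X → M} {g : X → N} (hf : ContDiff ℝ ∞ f) (hg : ContDiff ℝ ∞ g) {S : Set X} {n : ℕ}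
    {Cf Cg : ℝ} (hCf : ∀ i ≤ n, ∀ x ∈ S, ‖iteratedFDeriv ℝ i f x‖ ≤ Cf)
    (hCg : ∀ i ≤ n, ∀ x ∈ S, ‖iteratedFDeriv ℝ i g x‖ ≤ Cg) :
    ∀ j ≤ n, ∀ x ∈ S, ‖iteratedFDeriv ℝ j (fun y => B (f y) (g y)) x‖ ≤ ‖B‖ * 2 ^ n * Cf * Cg := by
  intro j hj x hx
  have hCf0 : 0 ≤ Cf := (norm_nonneg _).trans (hCf 0 (Nat.zero_le _) x hx)
  have hCg0 : 0 ≤ Cg := (norm_nonneg _).trans (hCg 0 (Nat.zero_le _) x hx)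
  have h := B.norm_iteratedFDeriv_le_of_bilinear hf hg x (n := j) (mod_cast le_top)
  refine h.trans ?_
  have hsum : ∑ i ∈ Finset.range (j + 1),
      (j.choose i : ℝ) * ‖iteratedFDeriv ℝ i f x‖ * ‖iteratedFDeriv ℝ (j - i) g x‖ ≤
      ∑ i ∈ Finset.range (j + 1), (j.choose i : ℝ) * (Cf * Cg) := by
    refine Finset.sum_le_sum fun i hi => ?_
    have hij : i ≤ j := Nat.lt_succ_iff.1 (Finset.mem_range.1 hi)
    rw [mul_assoc]
    refine mul_le_mul_of_nonneg_left ?_ (by positivity)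
    exact mul_le_mul (hCf i (hij.trans hj) x hx) (hCg (j - i) ((Nat.sub_le j i).trans hj) x hx)
      (norm_nonneg _) hCf0
  have hchoose : ∑ i ∈ Finset.range (j + 1), (j.choose i : ℝ) * (Cf * Cg) = 2 ^ j * (Cf * Cg) := by
    rw [← Finset.sum_mul]
    congr 1
    have := Nat.sum_range_choose j
    exact_mod_cast this
  have h2 : (2 : ℝ) ^ j ≤ 2 ^ n := pow_le_pow_right₀ (by norm_num) hj
  calc ‖B‖ * ∑ i ∈ Finset.range (j + 1),
        (j.choose i : ℝ) * ‖iteratedFDeriv ℝ i f x‖ * ‖iteratedFDeriv ℝ (j - i) g x‖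
      ≤ ‖B‖ * (2 ^ j * (Cf * Cg)) := by
        rw [← hchoose]; exact mul_le_mul_of_nonneg_left hsum (norm_nonneg _)
    _ ≤ ‖B‖ * (2 ^ n * (Cf * Cg)) := by gcongr
    _ = ‖B‖ * 2 ^ n * Cf * Cg := by ring

/-- Derivatives of a smooth function with bounded derivatives, precomposed with a continuous
linear map, are uniformly bounded. -/
theorem norm_iteratedFDeriv_comp_clm_le_uniform {X Y Z : Type*} [NormedAddCommGroup X]
    [NormedSpace ℝ X] [NormedAddCommGroup Y] [NormedSpace ℝ Y] [NormedAddCommGroup Z]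
    [NormedSpace ℝ Z] {h : Y → Z} (hh : ContDiff ℝ ∞ h)
    (hb : ∀ n, ∃ C, ∀ y, ‖iteratedFDeriv ℝ n h y‖ ≤ C) (A : X →L[ℝ] Y) (n : ℕ) :
    ∃ C, ∀ i ≤ n, ∀ x, ‖iteratedFDeriv ℝ i (h ∘ A) x‖ ≤ C := by
  choose C hC using hb
  refine ⟨(∑ i ∈ Finset.range (n + 1), |C i|) * max 1 ‖A‖ ^ n, fun i hi x => ?_⟩
  rw [A.iteratedFDeriv_comp_right hh x (mod_cast le_top)]
  refine (ContinuousMultilinearMap.norm_compContinuousLinearMap_le _ _).trans ?_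
  rw [Finset.prod_const, Finset.card_univ, Fintype.card_fin]
  have h1 : ‖iteratedFDeriv ℝ i h (A x)‖ ≤ ∑ i ∈ Finset.range (n + 1), |C i| :=
    ((hC i (A x)).trans (le_abs_self _)).trans
      (Finset.single_le_sum (f := fun i => |C i|) (fun _ _ => abs_nonneg _)
        (Finset.mem_range.2 (Nat.lt_succ_of_le hi)))
  have h2 : ‖A‖ ^ i ≤ max 1 ‖A‖ ^ n :=
    (pow_le_pow_left₀ (norm_nonneg _) (le_max_right _ _) i).trans
      (pow_le_pow_right₀ (le_max_left _ _) hi)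
  exact mul_le_mul h1 h2 (by positivity) (Finset.sum_nonneg fun _ _ => abs_nonneg _)

variable {β : ℝ → E → E} {γ : ℝ → E → ℝ}
  {F : E × (ℝ × ℝ) × (E →L[ℝ] ℝ × ℝ) → ℝ × ℝ}

/-- **The clock system is smooth.** The nonlinearity
`F(x, (ψ, σ), P) = ((P (β σ x))₁ + γ σ x · ψ, 1)` of the autonomous system for the pair
`(ψ, clock)` is `C^∞` when `β`, `γ` are jointly `C^∞`. -/
theorem clock_contDiff (hβ : ContDiff ℝ ∞ (uncurry β)) (hγ : ContDiff ℝ ∞ (uncurry γ))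
    (hF : F = fun q => ((q.2.2 (β q.2.1.2 q.1)).1 + γ q.2.1.2 q.1 * q.2.1.1, 1)) :
    ContDiff ℝ ∞ F := by
  rw [hF]
  have hL : ContDiff ℝ ∞ fun q : E × (ℝ × ℝ) × (E →L[ℝ] ℝ × ℝ) => (q.2.1.2, q.1) := by fun_prop
  have hb : ContDiff ℝ ∞ fun q : E × (ℝ × ℝ) × (E →L[ℝ] ℝ × ℝ) => β q.2.1.2 q.1 := hβ.comp hL
  have hg : ContDiff ℝ ∞ fun q : E × (ℝ × ℝ) × (E →L[ℝ] ℝ × ℝ) => γ q.2.1.2 q.1 := hγ.comp hL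
  have hP : ContDiff ℝ ∞ fun q : E × (ℝ × ℝ) × (E →L[ℝ] ℝ × ℝ) => q.2.2 := by fun_prop
  have hev : ContDiff ℝ ∞ fun q : E × (ℝ × ℝ) × (E →L[ℝ] ℝ × ℝ) => q.2.2 (β q.2.1.2 q.1) :=
    hP.clm_apply hb
  exact ((hev.fst).add (hg.mul (by fun_prop))).prodMk contDiff_const

set_option maxHeartbeats 400000 in
/-- **Derivative bounds for the clock system**: with `β`, `γ` jointly `C^∞` with all
derivatives bounded, all derivatives of order `≤ n` of `F` are bounded on `E × {‖w‖ ≤ R}`, for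
every `n` and `R` (Leibniz bounds for the bilinear expressions `P(β)` and `γ · ψ`). -/
theorem clock_bounds (hβ : ContDiff ℝ ∞ (uncurry β)) (hγ : ContDiff ℝ ∞ (uncurry γ))
    (hβb : ∀ n, ∃ C, ∀ p, ‖iteratedFDeriv ℝ n (uncurry β) p‖ ≤ C)
    (hγb : ∀ n, ∃ C, ∀ p, ‖iteratedFDeriv ℝ n (uncurry γ) p‖ ≤ C)
    (hF : F = fun q => ((q.2.2 (β q.2.1.2 q.1)).1 + γ q.2.1.2 q.1 * q.2.1.1, 1)) :
    ∀ (n : ℕ) (R : ℝ), ∃ B, 0 ≤ B ∧ ∀ j ≤ n, ∀ (x : E) (w : (ℝ × ℝ) × (E →L[ℝ] ℝ × ℝ)),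
      ‖w‖ ≤ R → ‖iteratedFDeriv ℝ j F (x, w)‖ ≤ B := by
  intro n R
  -- the linear maps
  set L₁ : (E × (ℝ × ℝ) × (E →L[ℝ] ℝ × ℝ)) →L[ℝ] ℝ × E :=
    ((ContinuousLinearMap.snd ℝ ℝ ℝ).comp ((ContinuousLinearMap.fst ℝ (ℝ × ℝ) (E →L[ℝ] ℝ × ℝ)).comp
      (ContinuousLinearMap.snd ℝ E ((ℝ × ℝ) × (E →L[ℝ] ℝ × ℝ))))).prod
      (ContinuousLinearMap.fst ℝ E ((ℝ × ℝ) × (E →L[ℝ] ℝ × ℝ))) with hL₁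
  set πP : (E × (ℝ × ℝ) × (E →L[ℝ] ℝ × ℝ)) →L[ℝ] (E →L[ℝ] ℝ × ℝ) :=
    (ContinuousLinearMap.snd ℝ (ℝ × ℝ) (E →L[ℝ] ℝ × ℝ)).comp
      (ContinuousLinearMap.snd ℝ E ((ℝ × ℝ) × (E →L[ℝ] ℝ × ℝ))) with hπP
  set πψ : (E × (ℝ × ℝ) × (E →L[ℝ] ℝ × ℝ)) →L[ℝ] ℝ :=
    (ContinuousLinearMap.fst ℝ ℝ ℝ).comp ((ContinuousLinearMap.fst ℝ (ℝ × ℝ) (E →L[ℝ] ℝ × ℝ)).comp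
      (ContinuousLinearMap.snd ℝ E ((ℝ × ℝ) × (E →L[ℝ] ℝ × ℝ)))) with hπψ
  set Bev : (E →L[ℝ] ℝ × ℝ) →L[ℝ] E →L[ℝ] ℝ × ℝ := ContinuousLinearMap.id ℝ (E →L[ℝ] ℝ × ℝ)
    with hBev
  set Bmul : ℝ →L[ℝ] ℝ →L[ℝ] ℝ := ContinuousLinearMap.mul ℝ ℝ with hBmul
  set S : Set (E × (ℝ × ℝ) × (E →L[ℝ] ℝ × ℝ)) := {q | ‖q.2‖ ≤ R} with hS
  -- the factors and their bounds on `S`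
  have hb : ContDiff ℝ ∞ (uncurry β ∘ L₁) := hβ.comp L₁.contDiff
  have hg : ContDiff ℝ ∞ (uncurry γ ∘ L₁) := hγ.comp L₁.contDiff
  obtain ⟨Cb, hCb⟩ := norm_iteratedFDeriv_comp_clm_le_uniform hβ hβb L₁ n
  obtain ⟨Cg, hCg⟩ := norm_iteratedFDeriv_comp_clm_le_uniform hγ hγb L₁ n
  have hP : ∀ i ≤ n, ∀ q ∈ S, ‖iteratedFDeriv ℝ i πP q‖ ≤ |R| + ‖πP‖ := by
    intro i _ q hq
    refine (norm_iteratedFDeriv_clm_le πP i q).trans (add_le_add ?_ le_rfl)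
    have : ‖πP q‖ ≤ ‖q.2‖ := by simp only [hπP, ContinuousLinearMap.coe_comp, comp_apply,
      ContinuousLinearMap.coe_snd']; exact norm_snd_le q.2
    exact this.trans (hq.trans (le_abs_self R))
  have hψ : ∀ i ≤ n, ∀ q ∈ S, ‖iteratedFDeriv ℝ i πψ q‖ ≤ |R| + ‖πψ‖ := by
    intro i _ q hq
    refine (norm_iteratedFDeriv_clm_le πψ i q).trans (add_le_add ?_ le_rfl)
    have : ‖πψ q‖ ≤ ‖q.2‖ := by
      simp only [hπψ, ContinuousLinearMap.coe_comp, comp_apply, ContinuousLinearMap.coe_snd',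
        ContinuousLinearMap.coe_fst']
      exact (norm_fst_le q.2.1).trans (norm_fst_le q.2)
    exact this.trans (hq.trans (le_abs_self R))
  have h1 := norm_iteratedFDeriv_bilinear_le_uniform Bev πP.contDiff hb hP
    (fun i hi q _ => hCb i hi q)
  have h2 := norm_iteratedFDeriv_bilinear_le_uniform Bmul hg πψ.contDiff
    (fun i hi q _ => hCg i hi q) hψ
  -- the first component of `F`
  set F₁ : E × (ℝ × ℝ) × (E →L[ℝ] ℝ × ℝ) → ℝ := fun q =>
    (q.2.2 (β q.2.1.2 q.1)).1 + γ q.2.1.2 q.1 * q.2.1.1 with hF₁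
  have hT₁ : ContDiff ℝ ∞ fun q : E × (ℝ × ℝ) × (E →L[ℝ] ℝ × ℝ) =>
      Bev (πP q) ((uncurry β ∘ L₁) q) := πP.contDiff.clm_apply hb
  have hT₂ : ContDiff ℝ ∞ fun q : E × (ℝ × ℝ) × (E →L[ℝ] ℝ × ℝ) =>
      Bmul ((uncurry γ ∘ L₁) q) (πψ q) := by
    simp only [hBmul, ContinuousLinearMap.mul_apply']
    exact hg.mul πψ.contDiff
  have hF₁eq : F₁ = fun q => ((ContinuousLinearMap.fst ℝ ℝ ℝ) ∘
      (fun q => Bev (πP q) ((uncurry β ∘ L₁) q))) q +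
      (fun q => Bmul ((uncurry γ ∘ L₁) q) (πψ q)) q := by
    funext q
    simp [hF₁, hBev, hBmul, hπP, hπψ, hL₁]
  have hT₁' : ContDiff ℝ ∞ ((ContinuousLinearMap.fst ℝ ℝ ℝ) ∘
      (fun q => Bev (πP q) ((uncurry β ∘ L₁) q))) :=
    (ContinuousLinearMap.fst ℝ ℝ ℝ).contDiff.comp hT₁
  have hF₁s : ContDiff ℝ ∞ F₁ := by rw [hF₁eq]; exact hT₁'.add hT₂
  set K : ℝ := ‖ContinuousLinearMap.fst ℝ ℝ ℝ‖ * (‖Bev‖ * 2 ^ n * (|R| + ‖πP‖) * Cb) +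
    ‖Bmul‖ * 2 ^ n * Cg * (|R| + ‖πψ‖) with hK
  have hF₁b : ∀ j ≤ n, ∀ q ∈ S, ‖iteratedFDeriv ℝ j F₁ q‖ ≤ K := by
    intro j hj q hq
    rw [hF₁eq, fun_iteratedFDeriv_add_apply (hT₁'.contDiffAt.of_le (mod_cast le_top))
      (hT₂.contDiffAt.of_le (mod_cast le_top))]
    refine (norm_add_le _ _).trans (add_le_add ?_ (h2 j hj q hq))
    refine ((ContinuousLinearMap.fst ℝ ℝ ℝ).norm_iteratedFDeriv_comp_left
      (hT₁.contDiffAt) (n := j) (mod_cast le_top)).trans ?_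
    exact mul_le_mul_of_nonneg_left (h1 j hj q hq) (norm_nonneg _)
  -- the pair
  refine ⟨max K 1, le_max_of_le_right zero_le_one, fun j hj x w hw => ?_⟩
  have hq : ((x, w) : E × (ℝ × ℝ) × (E →L[ℝ] ℝ × ℝ)) ∈ S := by simpa [hS] using hw
  have hFeq : F = fun q => (F₁ q, (fun _ : E × (ℝ × ℝ) × (E →L[ℝ] ℝ × ℝ) => (1 : ℝ)) q) := by
    rw [hF]
  rw [hFeq, iteratedFDeriv_prodMk (hF₁s.contDiffAt.of_le (mod_cast le_top))
    (contDiff_const.contDiffAt.of_le (mod_cast le_top)) le_rfl, ContinuousMultilinearMap.opNorm_prod]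
  refine max_le_max (hF₁b j hj _ hq) ?_
  rcases j with _ | j
  · simp
  · rw [iteratedFDeriv_const_of_ne (by omega)]
    simp



/-- Anchor (registered sub-stub of stub W2): derivatives of a continuous linear map on `ℝ³`
(closed form of `norm_iteratedFDeriv_clm_le`, for the record). -/
theorem w2aux_clmIteratedFDeriv : ∀ (A : EuclideanSpace ℝ (Fin 3) →L[ℝ] ℝ) (n : ℕ)
    (x : EuclideanSpace ℝ (Fin 3)), ‖iteratedFDeriv ℝ n A x‖ ≤ ‖A x‖ + ‖A‖ :=
  fun A n x => norm_iteratedFDeriv_clm_le A n x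

end Clock

end Summit.NavierStokesRegularity.NavierStokesRegularity.Theorems.SelfMixingDichotomy.MixingPayoffBirth

end
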